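import Summits.QuantumFields.YangMills.Theorems.FlatTubeReductionValleyRelocalisationAgmonPrelim
import Summits.QuantumFields.YangMills.Theorems.FemtoTransferGapMultiplierIMSLipschitz
import Summits.QuantumFields.YangMills.Theorems.LuscherReductionRunningReductionInnerCopiesForm
import Summits.QuantumFields.YangMills.Theorems.LuscherReductionRunningReductionInnerPhase
import Summits.QuantumFields.YangMills.Theorems.FemtoCutoffLadderFixedLatticeLawOffTubeKernel
import HarnessLib

/-!
# Route `FlatTubeReduction` (K1 `NearFlatRatioLaw`, items 24720 / 27141; pool `FixedLatticeLaw` 23943): ONE ONION LAYER for the exact ground state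
# (rung R2b1 = RECORD-label femto gap; no summit statement is proved here)

Seat `ym-line-ftr-p1` g4 (prover).  Toward the CONCENTRATION of the exact positive zero-flux ground state `Ω` (`K_βΩ = λ₀Ω`) of the `SU(2)`
transfer operator on `(ℤ/L)³` at the eight twisted pure-gauge orbits (companion file `…GroundStateConcentration`): the one-layer estimate in
RED's `orbitDist`/`innerPhase` vocabulary, from the product (ground-state transformation) identity `energy_mul_le_of_linkLipschitz_pos`
applied with `η = g₁Ω` (the PREVIOUS layer), the kernel locality `transferKernel_le_crossBound`, and the large-field Schur bounds
`tail_bound` / `sq_cross_le` / `qform_le_exp_neg_of_action_ge_lat`.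
* §1 support facts of the inner phase (`sin Θ_r = 1` off the `r`-neighbourhoods, `cos Θ_r = 1` on the `r/2`-neighbourhoods, link separation);
* §2 ★ `abs_qform_le_crossBound_of_sep` — locality of the transfer form across link-separated supports;
* §3 ★ `eigen_bracket_le` — for the exact eigenvector the product-identity bracket of a cut-off `g` against `η = g₁Ω` (`g₁ = 1` on `supp g`,
  `supp g` and `{g₁ ≠ 1}` link-separated by `R`) equals `⟨g²g₁Ω, K_β((1−g₁)Ω)⟩ ≤ crossBound L β R·‖Ω‖²`;
* §4 ★★ `layer_mass_le` — ONE onion layer: with a gain `γ` on `{S ≤ η} ∩ supp g`,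
  `‖gΩ‖² ≤ (2/(γλ₀))[crossBound‖Ω‖² + ε_Λ‖g₁Ω‖² + (1+2/γ)κ_η‖Ω‖²] + (κ_η/λ₀)‖Ω‖²` — the IMS defect `ε_Λ` is paid on the previous layer's mass.
HONEST FRAMING: fixed-lattice bookkeeping around landed estimates; nothing here is infinite volume, a continuum limit or the Clay mass gap.
No definitions, no named facts, no `sorry`.  References: B. Simon, Ann. Phys. 146 (1983) 209 [cite: SimonB1983DiscreteSpectrum, §3];
M. Lüscher, NPB 219 (1983) 233 [cite: Luscher1983, §2–3]; Montvay–Münster [cite: MontvayMunster1994, §3.2.3].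
-/

set_option autoImplicit false

noncomputable section

open MeasureTheory Filter Topology Real
open scoped Matrix BigOperators
open Literature.MathematicalPhysics.QuantumFieldTheory hiding SU2
open Literature.MathematicalPhysics.QuantumLattice

namespace Summit.QuantumFields.YangMills.Theorems.FemtoTransferGap

namespace GroundConc

open Summit.QuantumFields.YangMills.Theorems.FemtoTransferGap.OffTube
open Summit.QuantumFields.YangMills.Theorems.FemtoCutoffLadder

variable {L : ℕ} [NeZero L]

/-! ## §1 Support facts of the inner phase -/

/-- `sin Θ_r(U) = 1` as soon as every twisted orbit distance is `≥ r` (`r > 0`): all bumps vanish, `Θ_r = π/2`. [folklore] -/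
theorem sin_innerPhase_eq_one {r : ℝ} (hr : 0 < r) {U : GaugeConfig 3 L SU2}
    (h : ∀ z : Fin 3 → Bool, r ≤ orbitDist (TT.twist3 z U)) : Real.sin (innerPhase r U) = 1 := by
  have hprod : ∏ w : Fin 3 → Bool, (1 - bump (orbitDist (TT.twist3 w U) / r)) = 1 := by
    refine Finset.prod_eq_one fun w _ => ?_
    rw [bump_eq_zero (by rw [le_div_iff₀ hr, one_mul]; exact h w), sub_zero]
  unfold innerPhase
  rw [hprod, mul_one, Real.sin_pi_div_two]

/-- `cos Θ_r(U) = 1` as soon as some twisted orbit distance is `≤ r/2` (`r > 0`): one bump equals `1`, `Θ_r = 0`. [folklore] -/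
theorem cos_innerPhase_eq_one {r : ℝ} (hr : 0 < r) {U : GaugeConfig 3 L SU2}
    (h : ∃ z : Fin 3 → Bool, orbitDist (TT.twist3 z U) ≤ r / 2) : Real.cos (innerPhase r U) = 1 := by
  obtain ⟨z, hz⟩ := h
  have hb : bump (orbitDist (TT.twist3 z U) / r) = 1 := bump_eq_one (by rw [div_le_iff₀ hr]; linarith)
  have hprod : ∏ w : Fin 3 → Bool, (1 - bump (orbitDist (TT.twist3 w U) / r)) = 0 :=
    Finset.prod_eq_zero (Finset.mem_univ z) (by rw [hb, sub_self])
  unfold innerPhase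
  rw [hprod, mul_zero, Real.cos_zero]

/-- If `sin Θ_r(U) ≠ 0` and `r' ≤ r/2` then `sin Θ_{r'}(U) = 1` (`r' > 0`). [folklore] -/
theorem sin_innerPhase_eq_one_of_sin_ne_zero {r r' : ℝ} (hr : 0 < r) (hr' : 0 < r') (hrr : r' ≤ r / 2) {U : GaugeConfig 3 L SU2}
    (h : Real.sin (innerPhase r U) ≠ 0) : Real.sin (innerPhase r' U) = 1 :=
  sin_innerPhase_eq_one hr' fun z => by linarith [forall_lt_orbitDist_of_sin_ne_zero hr h z]

/-- Link separation from orbit-distance separation: if every twisted orbit distance of `U` exceeds `a` and some twisted orbit distance of `V`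
is `< b ≤ a`, then `Σ_e ‖U_e − V_e‖_F ≥ a − b` (1-Lipschitz orbit distances). [folklore] -/
theorem sum_frobNorm_ge_of_orbitDist {a b : ℝ} {U V : GaugeConfig 3 L SU2} (hU : ∀ z : Fin 3 → Bool, a < orbitDist (TT.twist3 z U))
    (hV : ∃ z : Fin 3 → Bool, orbitDist (TT.twist3 z V) < b) :
    a - b ≤ ∑ e : Edge 3 L, frobNorm (((U e : SU2) : Matrix (Fin 2) (Fin 2) ℂ) - ((V e : SU2) : Matrix (Fin 2) (Fin 2) ℂ)) := by
  obtain ⟨z, hz⟩ := hV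
  have h := abs_orbitDist_twist3_sub_le z U V
  rw [abs_le] at h
  linarith [hU z, h.2]

/-! ## §2 Locality of the transfer form across link-separated supports -/

/-- ★ **Locality**: for physical `f`, `h` whose supports are link-separated by `R ≥ 0` (`f U ≠ 0`, `h V ≠ 0 ⇒ Σ_e‖U_e − V_e‖_F ≥ R`) and `β ≥ 0`:
`|⟨f, K_β h⟩| ≤ crossBound L β R · (‖f‖² + ‖h‖²)/2` (pointwise `K ≤ crossBound` on the product of the supports, Schur–Young). [cite: MontvayMunster1994, §3.2.3] -/
theorem abs_qform_le_crossBound_of_sep {β : ℝ} (hβ : 0 ≤ β) {f h : GaugeConfig 3 L SU2 → ℝ} (hf : IsPhys f) (hh : IsPhys h)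
    {R : ℝ} (hR : 0 ≤ R)
    (hsep : ∀ U V, f U ≠ 0 → h V ≠ 0 →
      R ≤ ∑ e : Edge 3 L, frobNorm (((U e : SU2) : Matrix (Fin 2) (Fin 2) ℂ) - ((V e : SU2) : Matrix (Fin 2) (Fin 2) ℂ))) :
    |qform su2Rep β f h| ≤ crossBound L β R * (l2 f f + l2 h h) / 2 := by
  obtain ⟨Cf, hCf⟩ := hf.bounded
  obtain ⟨Ch, hCh⟩ := hh.bounded
  have hpt : ∀ p : GaugeConfig 3 L SU2 × GaugeConfig 3 L SU2,
      |f p.1 * transferKernel su2Rep β p.1 p.2 * h p.2| ≤ crossBound L β R * ((f p.1 ^ 2 + h p.2 ^ 2) / 2) := by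
    intro p
    have hRHS : 0 ≤ crossBound L β R * ((f p.1 ^ 2 + h p.2 ^ 2) / 2) := mul_nonneg (crossBound_pos β R).le (by positivity)
    by_cases ha : f p.1 = 0
    · have h0 : |f p.1 * transferKernel su2Rep β p.1 p.2 * h p.2| = 0 := by rw [ha, zero_mul, zero_mul, abs_zero]
      rw [h0]; exact hRHS
    by_cases hb : h p.2 = 0
    · have h0 : |f p.1 * transferKernel su2Rep β p.1 p.2 * h p.2| = 0 := by rw [hb, mul_zero, abs_zero]
      rw [h0]; exact hRHS
    have hK : transferKernel su2Rep β p.1 p.2 ≤ crossBound L β R := transferKernel_le_crossBound hβ hR (hsep _ _ ha hb)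
    rw [abs_mul, abs_mul, abs_of_pos (transferKernel_pos _ _ _ _)]
    have h2 : 2 * (|f p.1| * |h p.2|) ≤ f p.1 ^ 2 + h p.2 ^ 2 := by
      have h := two_mul_le_add_sq |f p.1| |h p.2|
      rw [sq_abs, sq_abs] at h; linarith
    calc |f p.1| * transferKernel su2Rep β p.1 p.2 * |h p.2|
        = transferKernel su2Rep β p.1 p.2 * (|f p.1| * |h p.2|) := by ring
      _ ≤ crossBound L β R * (|f p.1| * |h p.2|) := mul_le_mul_of_nonneg_right hK (by positivity)
      _ ≤ crossBound L β R * ((f p.1 ^ 2 + h p.2 ^ 2) / 2) := mul_le_mul_of_nonneg_left (by linarith) (crossBound_pos β R).le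
  have hfsq : ∀ U, |f U ^ 2| ≤ Cf ^ 2 := fun U => by rw [abs_pow]; exact pow_le_pow_left₀ (abs_nonneg _) (hCf U) 2
  have hhsq : ∀ U, |h U ^ 2| ≤ Ch ^ 2 := fun U => by rw [abs_pow]; exact pow_le_pow_left₀ (abs_nonneg _) (hCh U) 2
  have ha : Integrable (fun p : GaugeConfig 3 L SU2 × GaugeConfig 3 L SU2 => f p.1 ^ 2) ((configMeasure SU2 L).prod (configMeasure SU2 L)) :=
    integrable_latProd ((hf.measurable.pow_const 2).comp measurable_fst) fun p => hfsq p.1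
  have hb : Integrable (fun p : GaugeConfig 3 L SU2 × GaugeConfig 3 L SU2 => h p.2 ^ 2) ((configMeasure SU2 L).prod (configMeasure SU2 L)) :=
    integrable_latProd ((hh.measurable.pow_const 2).comp measurable_snd) fun p => hhsq p.2
  have hint : Integrable (fun p : GaugeConfig 3 L SU2 × GaugeConfig 3 L SU2 => crossBound L β R * ((f p.1 ^ 2 + h p.2 ^ 2) / 2))
      ((configMeasure SU2 L).prod (configMeasure SU2 L)) := ((ha.add hb).div_const 2).const_mul _
  rw [qform_eq_integral_prod su2Rep continuous_su2Rep β hf hh]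
  calc |∫ p, f p.1 * transferKernel su2Rep β p.1 p.2 * h p.2 ∂(configMeasure SU2 L).prod (configMeasure SU2 L)|
      ≤ ∫ p, |f p.1 * transferKernel su2Rep β p.1 p.2 * h p.2| ∂(configMeasure SU2 L).prod (configMeasure SU2 L) :=
        abs_integral_le_integral_abs
    _ ≤ ∫ p, crossBound L β R * ((f p.1 ^ 2 + h p.2 ^ 2) / 2) ∂(configMeasure SU2 L).prod (configMeasure SU2 L) :=
        integral_mono_of_nonneg (ae_of_all _ fun p => abs_nonneg _) hint (ae_of_all _ fun p => hpt p)
    _ = crossBound L β R * (l2 f f + l2 h h) / 2 := by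
        rw [integral_const_mul, integral_div, integral_add ha hb,
          integral_fun_fst (μ := configMeasure SU2 L) (ν := configMeasure SU2 L) (fun U : GaugeConfig 3 L SU2 => f U ^ 2),
          integral_fun_snd (μ := configMeasure SU2 L) (ν := configMeasure SU2 L) (fun V : GaugeConfig 3 L SU2 => h V ^ 2),
          probReal_univ, one_smul, one_smul]
        unfold l2
        have e1 : ∫ U, f U ^ 2 ∂configMeasure SU2 L = ∫ U, f U * f U ∂configMeasure SU2 L :=
          integral_congr_ae (ae_of_all _ fun U => by ring)
        have e2 : ∫ U, h U ^ 2 ∂configMeasure SU2 L = ∫ U, h U * h U ∂configMeasure SU2 L :=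
          integral_congr_ae (ae_of_all _ fun U => by ring)
        rw [e1, e2]; ring


/-! ## §3 The product-identity bracket of the exact eigenvector against a localised copy of itself -/

/-- ★ **Bracket bound.**  `Ω` physical with `K_βΩ = λ₀Ω`; `g`, `g₁` bounded measurable gauge- and twist-invariant cut-offs (`|g| ≤ 1`, `0 ≤ g₁ ≤ 1`) with
`g₁ = 1` on `supp g` and `supp g`, `{g₁ ≠ 1}` link-separated by `R ≥ 0`.  Then, with `Ω₁ = g₁Ω`,
`λ₀⟨g²Ω₁, Ω₁⟩ − ⟨g²Ω₁, K_βΩ₁⟩ = ⟨g²Ω₁, K_β((1−g₁)Ω)⟩ ≤ crossBound L β R · ‖Ω‖²`. [cite: SimonB1983DiscreteSpectrum, §3] -/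
theorem eigen_bracket_le {β : ℝ} (hβ : 0 ≤ β) {Ω : GaugeConfig 3 L SU2 → ℝ} (hΩ : IsPhys Ω)
    (heig : transferApply β Ω = topValue su2Rep L β • Ω)
    {g g₁ : GaugeConfig 3 L SU2 → ℝ} (hgm : Measurable g) (hgb : ∀ U, |g U| ≤ 1)
    (hgg : ∀ (k : Site 3 L → SU2) (U : GaugeConfig 3 L SU2), g (gaugeTransform k U) = g U)
    (hgz : ∀ (k : Fin 3), ∀ z ∈ Subgroup.center SU2, ∀ U : GaugeConfig 3 L SU2, g (twist k z U) = g U)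
    (hg₁m : Measurable g₁) (hg₁0 : ∀ U, 0 ≤ g₁ U) (hg₁1 : ∀ U, g₁ U ≤ 1)
    (hg₁g : ∀ (k : Site 3 L → SU2) (U : GaugeConfig 3 L SU2), g₁ (gaugeTransform k U) = g₁ U)
    (hg₁z : ∀ (k : Fin 3), ∀ z ∈ Subgroup.center SU2, ∀ U : GaugeConfig 3 L SU2, g₁ (twist k z U) = g₁ U)
    (hgg₁ : ∀ U, g U ≠ 0 → g₁ U = 1) {R : ℝ} (hR : 0 ≤ R)
    (hloc : ∀ U V, g U ≠ 0 → g₁ V ≠ 1 →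
      R ≤ ∑ e : Edge 3 L, frobNorm (((U e : SU2) : Matrix (Fin 2) (Fin 2) ℂ) - ((V e : SU2) : Matrix (Fin 2) (Fin 2) ℂ))) :
    topValue su2Rep L β * l2 (fun U => g U ^ 2 * (g₁ U * Ω U)) (fun U => g₁ U * Ω U)
        - l2 (fun U => g U ^ 2 * (g₁ U * Ω U)) (transferApply β (fun U => g₁ U * Ω U))
      ≤ crossBound L β R * l2 Ω Ω := by
  set lam := topValue su2Rep L β with hlam
  set Ω₁ : GaugeConfig 3 L SU2 → ℝ := fun U => g₁ U * Ω U with hΩ₁def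
  set F : GaugeConfig 3 L SU2 → ℝ := fun U => g U ^ 2 * Ω₁ U with hFdef
  set D : GaugeConfig 3 L SU2 → ℝ := fun U => (1 - g₁ U) * Ω U with hDdef
  have hg₁b : ∀ U, |g₁ U| ≤ 1 := fun U => by rw [abs_of_nonneg (hg₁0 U)]; exact hg₁1 U
  have hΩ₁ : IsPhys Ω₁ := hΩ.mul_of_invariant hg₁m (CJ := 1) hg₁b hg₁g hg₁z
  have hF : IsPhys F := hΩ₁.sq_mul_of_invariant hgm (Cg := 1) hgb hgg hgz
  have hD : IsPhys D := hΩ.mul_of_invariant (measurable_const.sub hg₁m) (CJ := 1)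
    (fun U => by rw [abs_le]; constructor <;> linarith [hg₁0 U, hg₁1 U])
    (fun k U => by rw [hg₁g k U]) (fun k z hz U => by rw [hg₁z k z hz U])
  -- `Ω = Ω₁ + D`
  have hsum : Ω = Ω₁ + D := by funext U; simp only [hΩ₁def, hDdef, Pi.add_apply]; ring
  -- `⟨F, K Ω₁⟩ = λ₀⟨F,Ω⟩ − ⟨F, K D⟩`
  have hq : qform su2Rep β F Ω₁ = lam * l2 F Ω - qform su2Rep β F D := by
    have h1 : qform su2Rep β F Ω = qform su2Rep β F Ω₁ + qform su2Rep β F D := by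
      conv_lhs => rw [hsum]
      exact OffTube.qform_add_right β hF hΩ₁ hD
    have h2 : qform su2Rep β F Ω = lam * l2 F Ω := qform_eigen_right β heig F
    linarith
  -- `⟨F, Ω⟩ = ⟨F, Ω₁⟩` (pointwise `F·D = 0`)
  have hFD : l2 F D = 0 := by
    unfold l2
    refine (integral_congr_ae (ae_of_all _ fun U => ?_)).trans (integral_zero _ _)
    simp only [hFdef, hDdef, hΩ₁def]
    by_cases hU : g U = 0
    · rw [hU]; ring
    · rw [hgg₁ U hU]; ring
  have hl : l2 F Ω = l2 F Ω₁ := by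
    have h1 : l2 F Ω = l2 F Ω₁ + l2 F D := by
      rw [l2_comm F Ω, l2_comm F Ω₁, l2_comm F D]
      conv_lhs => rw [hsum]
      exact l2_add_left hΩ₁ hD hF
    rw [h1, hFD, add_zero]
  -- locality of `⟨F, K D⟩`
  have hsep : ∀ U V, F U ≠ 0 → D V ≠ 0 →
      R ≤ ∑ e : Edge 3 L, frobNorm (((U e : SU2) : Matrix (Fin 2) (Fin 2) ℂ) - ((V e : SU2) : Matrix (Fin 2) (Fin 2) ℂ)) := by
    intro U V hFU hDV
    have hgU : g U ≠ 0 := fun h0 => hFU (by simp only [hFdef, h0]; ring)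
    have hg₁V : g₁ V ≠ 1 := fun h1 => hDV (by simp only [hDdef, h1]; ring)
    exact hloc U V hgU hg₁V
  have hloc' := abs_qform_le_crossBound_of_sep hβ hF hD hR hsep
  -- norms of `F`, `D` are at most `‖Ω‖²`
  have hnF : l2 F F ≤ l2 Ω Ω := by
    unfold l2
    refine integral_mono (hF.integrable_mul hF) (hΩ.integrable_mul hΩ) fun U => ?_
    simp only [hFdef, hΩ₁def]
    have h1 : g U ^ 2 ≤ 1 := by
      have := hgb U; rw [abs_le] at this; nlinarith
    have h2 : (g U ^ 2 * g₁ U) ^ 2 ≤ 1 := by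
      have h3 : 0 ≤ g U ^ 2 * g₁ U := mul_nonneg (sq_nonneg _) (hg₁0 U)
      have h4 : g U ^ 2 * g₁ U ≤ 1 := by nlinarith [hg₁1 U, hg₁0 U, sq_nonneg (g U)]
      nlinarith
    nlinarith [mul_self_nonneg (Ω U)]
  have hnD : l2 D D ≤ l2 Ω Ω := by
    unfold l2
    refine integral_mono (hD.integrable_mul hD) (hΩ.integrable_mul hΩ) fun U => ?_
    simp only [hDdef]
    have h2 : (1 - g₁ U) ^ 2 ≤ 1 := by nlinarith [hg₁0 U, hg₁1 U]
    nlinarith [mul_self_nonneg (Ω U)]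
  -- assemble
  rw [← qform_eq_l2_transferApply β F Ω₁, hq, hl]
  have h3 : qform su2Rep β F D ≤ crossBound L β R * (l2 F F + l2 D D) / 2 := (le_abs_self _).trans hloc'
  have h4 : crossBound L β R * (l2 F F + l2 D D) / 2 ≤ crossBound L β R * l2 Ω Ω := by
    have hc := (crossBound_pos (L := L) β R).le
    nlinarith
  linarith

/-! ## §4 One onion layer -/

/-- ★★ **One onion layer for the exact ground state.**  `β > 0`; `Ω` physical with `K_βΩ = λ₀Ω`; `g` a `Λ`-link-Lipschitz invariant cut-off
(`|g| ≤ 1`), `g₁` an invariant cut-off with `0 ≤ g₁ ≤ 1`, `g₁ = 1` on `supp g`, and `supp g`, `{g₁ ≠ 1}` link-separated by `R ≥ 0`; a GAIN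
`⟨f,K_βf⟩ ≤ (1−γ)λ₀‖f‖²` (`γ > 0`) for physical `f` supported in `{S ≤ η} ∩ {g ≠ 0}`.  Then
`‖gΩ‖² ≤ (2/(γλ₀))·[crossBound·‖Ω‖² + ε_Λ·‖g₁Ω‖² + (1 + 2/γ)κ_η·‖Ω‖²] + (κ_η/λ₀)‖Ω‖²`,
`ε_Λ = ½|E|²Λ²(3/β)c_β^{|E|}`, `κ_η = e^{−βη}c_β^{|E|}` — the IMS defect is paid on the PREVIOUS layer's mass `‖g₁Ω‖²` (product identity with
`η = g₁Ω`, bracket `≤ crossBound‖Ω‖²` by `eigen_bracket_le`). [cite: SimonB1983DiscreteSpectrum, §3] [cite: Luscher1983, §2] -/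
theorem layer_mass_le {β : ℝ} (hβ : 0 < β) {Ω : GaugeConfig 3 L SU2 → ℝ} (hΩ : IsPhys Ω)
    (heig : transferApply β Ω = topValue su2Rep L β • Ω)
    {g g₁ : GaugeConfig 3 L SU2 → ℝ} (hgm : Measurable g) (hgb : ∀ U, |g U| ≤ 1)
    (hgg : ∀ (k : Site 3 L → SU2) (U : GaugeConfig 3 L SU2), g (gaugeTransform k U) = g U)
    (hgz : ∀ (k : Fin 3), ∀ z ∈ Subgroup.center SU2, ∀ U : GaugeConfig 3 L SU2, g (twist k z U) = g U)
    {Λ : ℝ} (hLip : ∀ U V : GaugeConfig 3 L SU2,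
      |g U - g V| ≤ Λ * ∑ e, frobNorm ((U e : Matrix (Fin 2) (Fin 2) ℂ) - (V e : Matrix (Fin 2) (Fin 2) ℂ)))
    (hg₁m : Measurable g₁) (hg₁0 : ∀ U, 0 ≤ g₁ U) (hg₁1 : ∀ U, g₁ U ≤ 1)
    (hg₁g : ∀ (k : Site 3 L → SU2) (U : GaugeConfig 3 L SU2), g₁ (gaugeTransform k U) = g₁ U)
    (hg₁z : ∀ (k : Fin 3), ∀ z ∈ Subgroup.center SU2, ∀ U : GaugeConfig 3 L SU2, g₁ (twist k z U) = g₁ U)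
    (hgg₁ : ∀ U, g U ≠ 0 → g₁ U = 1) {R : ℝ} (hR : 0 ≤ R)
    (hloc : ∀ U V, g U ≠ 0 → g₁ V ≠ 1 →
      R ≤ ∑ e : Edge 3 L, frobNorm (((U e : SU2) : Matrix (Fin 2) (Fin 2) ℂ) - ((V e : SU2) : Matrix (Fin 2) (Fin 2) ℂ)))
    (η : ℝ) {γ : ℝ} (hγ : 0 < γ)
    (hgain : ∀ f : GaugeConfig 3 L SU2 → ℝ, IsPhys f → (∀ U, f U ≠ 0 → wilsonAction su2Rep U ≤ η ∧ g U ≠ 0) →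
      qform su2Rep β f f ≤ (1 - γ) * topValue su2Rep L β * l2 f f) :
    l2 (fun U => g U * Ω U) (fun U => g U * Ω U) ≤
      2 / (γ * topValue su2Rep L β) *
          (crossBound L β R * l2 Ω Ω
            + (1 / 2) * ((Fintype.card (Edge 3 L) : ℝ) ^ 2 * Λ ^ 2 * (3 / β) * latCE L β) * l2 (fun U => g₁ U * Ω U) (fun U => g₁ U * Ω U)
            + (1 + 2 / γ) * (Real.exp (-(β * η)) * latCE L β) * l2 Ω Ω)
        + Real.exp (-(β * η)) * latCE L β / topValue su2Rep L β * l2 Ω Ω := by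
  set lam := topValue su2Rep L β with hlam
  set T : Set (GaugeConfig 3 L SU2) := {V | wilsonAction su2Rep V ≤ η} with hTdef
  set Ω₁ : GaugeConfig 3 L SU2 → ℝ := fun U => g₁ U * Ω U with hΩ₁def
  set w : GaugeConfig 3 L SU2 → ℝ := fun U => g U * Ω₁ U with hwdef
  set u : GaugeConfig 3 L SU2 → ℝ := fun U => g U * T.indicator Ω U with hudef
  set v : GaugeConfig 3 L SU2 → ℝ := fun U => g U * Tᶜ.indicator Ω U with hvdef
  set ε : ℝ := (1 / 2) * ((Fintype.card (Edge 3 L) : ℝ) ^ 2 * Λ ^ 2 * (3 / β) * latCE L β) with hεdef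
  set κ : ℝ := Real.exp (-(β * η)) * latCE L β with hκdef
  have hlam0 : 0 < lam := topValue_su2Rep_pos L β
  have hκ0 : 0 ≤ κ := mul_nonneg (Real.exp_pos _).le (latCE_pos (L := L) hβ.le).le
  have hg₁b : ∀ U, |g₁ U| ≤ 1 := fun U => by rw [abs_of_nonneg (hg₁0 U)]; exact hg₁1 U
  have hΩ₁ : IsPhys Ω₁ := hΩ.mul_of_invariant hg₁m (CJ := 1) hg₁b hg₁g hg₁z
  have hΩT : IsPhys (T.indicator Ω) := isPhys_indicator_tube η hΩ
  have hΩTc : IsPhys (Tᶜ.indicator Ω) := isPhys_indicator_tube_compl η hΩ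
  have hw : IsPhys w := hΩ₁.mul_of_invariant hgm (CJ := 1) hgb hgg hgz
  have hu : IsPhys u := hΩT.mul_of_invariant hgm (CJ := 1) hgb hgg hgz
  have hv : IsPhys v := hΩTc.mul_of_invariant hgm (CJ := 1) hgb hgg hgz
  -- `w = gΩ = u + v` pointwise
  have hwΩ : (fun U => g U * Ω U) = w := by
    funext U; simp only [hwdef, hΩ₁def]
    by_cases hU : g U = 0
    · rw [hU]; ring
    · rw [hgg₁ U hU]; ring
  have hw_eq : w = u + v := by
    rw [← hwΩ]; funext U
    simp only [hudef, hvdef, Pi.add_apply]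
    by_cases hU : U ∈ T
    · rw [Set.indicator_of_mem hU, Set.indicator_of_notMem (fun h : U ∈ Tᶜ => (Set.mem_compl_iff T U).1 h hU)]; ring
    · rw [Set.indicator_of_notMem hU, Set.indicator_of_mem ((Set.mem_compl_iff T U).2 hU)]; ring
  have huv : l2 u v = 0 := by
    unfold l2
    refine (integral_congr_ae (ae_of_all _ fun U => ?_)).trans (integral_zero _ _)
    simp only [hudef, hvdef]
    by_cases hU : U ∈ T
    · rw [Set.indicator_of_notMem (fun h : U ∈ Tᶜ => (Set.mem_compl_iff T U).1 h hU)]; ring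
    · rw [Set.indicator_of_notMem hU]; ring
  have hnw : l2 w w = l2 u u + l2 v v := by rw [hw_eq, l2_add_add hu hv, huv]; ring
  have hqw : qform su2Rep β w w = qform su2Rep β u u + 2 * qform su2Rep β u v + qform su2Rep β v v := by
    rw [hw_eq, qform_add_add β hu hv]
  -- §A product identity with `η = Ω₁`, bracket by locality
  set F : GaugeConfig 3 L SU2 → ℝ := fun U => g U ^ 2 * Ω₁ U with hFdef
  have hprod : lam * l2 w w - qform su2Rep β w w ≤ (lam * l2 F Ω₁ - l2 F (transferApply β Ω₁)) + ε * l2 Ω₁ Ω₁ :=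
    energy_mul_le_of_linkLipschitz_pos hβ hgm (Cg := 1) hgb hgg hgz hLip hΩ₁ lam
  have hbr : lam * l2 F Ω₁ - l2 F (transferApply β Ω₁) ≤ crossBound L β R * l2 Ω Ω :=
    eigen_bracket_le hβ.le hΩ heig hgm hgb hgg hgz hg₁m hg₁0 hg₁1 hg₁g hg₁z hgg₁ hR hloc
  -- §B the estimates on `u`, `v`
  have hvsupp : ∀ U, v U ≠ 0 → η ≤ wilsonAction su2Rep U := by
    intro U hU
    have h2 : Tᶜ.indicator Ω U ≠ 0 := fun h0 => hU (by simp only [hvdef, h0, mul_zero])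
    have hUT : U ∈ Tᶜ := by
      by_contra hUT; exact h2 (Set.indicator_of_notMem hUT Ω)
    exact (lt_of_not_ge fun h => hUT h).le
  have hqv := qform_le_exp_neg_of_action_ge_lat hβ.le hv hvsupp
  have hcross := sq_cross_le hβ.le hu hv hvsupp
  have htail := tail_bound hβ.le (T := T) (η := η) (fun U hU => (lt_of_not_ge fun h => hU h).le) hΩ hΩTc heig
  have hqu : qform su2Rep β u u ≤ (1 - γ) * lam * l2 u u := by
    refine hgain u hu fun U hU => ?_
    have h1 : g U ≠ 0 := fun h0 => hU (by simp only [hudef, h0, zero_mul])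
    have h2 : T.indicator Ω U ≠ 0 := fun h0 => hU (by simp only [hudef, h0, mul_zero])
    have hUT : U ∈ T := by
      by_contra hUT; exact h2 (Set.indicator_of_notMem hUT Ω)
    exact ⟨hUT, h1⟩
  have hnu0 : 0 ≤ l2 u u := l2_self_nonneg u
  have hnv0 : 0 ≤ l2 v v := l2_self_nonneg v
  have hnvc : l2 v v ≤ l2 (Tᶜ.indicator Ω) (Tᶜ.indicator Ω) := by
    unfold l2
    refine integral_mono (hv.integrable_mul hv) (hΩTc.integrable_mul hΩTc) fun U => ?_
    simp only [hvdef]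
    have hs : g U ^ 2 ≤ 1 := by have := hgb U; rw [abs_le] at this; nlinarith
    have h0 : 0 ≤ Tᶜ.indicator Ω U * Tᶜ.indicator Ω U := mul_self_nonneg _
    have h1 := mul_le_mul_of_nonneg_right hs h0
    nlinarith [h1]
  have hncΩ : l2 (Tᶜ.indicator Ω) (Tᶜ.indicator Ω) ≤ l2 Ω Ω := l2_indicator_compl_self_le hΩT hΩTc
  have hnvΩ : l2 v v ≤ l2 Ω Ω := hnvc.trans hncΩ
  -- AM–GM on the cross term: `2⟨u,Kv⟩ ≤ (γ/2)λ₀‖u‖² + (2/γ)κ‖v‖²`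
  have hAMGM : 2 * qform su2Rep β u v ≤ (γ / 2) * lam * l2 u u + (2 / γ) * κ * l2 v v := by
    have hA : 0 ≤ (γ / 2) * lam * l2 u u := by positivity
    have hB : 0 ≤ (2 / γ) * κ * l2 v v := by positivity
    have hγγ : (γ / 2) * (2 / γ) = 1 := by
      rw [div_mul_div_comm, mul_comm γ 2, div_self (mul_ne_zero two_ne_zero hγ.ne')]
    have hAB : ((γ / 2) * lam * l2 u u) * ((2 / γ) * κ * l2 v v) = (lam * l2 u u) * (κ * l2 v v) := by
      rw [show ((γ / 2) * lam * l2 u u) * ((2 / γ) * κ * l2 v v) = ((γ / 2) * (2 / γ)) * ((lam * l2 u u) * (κ * l2 v v)) by ring,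
        hγγ, one_mul]
    have hsq : (2 * qform su2Rep β u v) ^ 2 ≤ ((γ / 2) * lam * l2 u u + (2 / γ) * κ * l2 v v) ^ 2 := by
      linarith only [hcross, hAB, sq_nonneg ((γ / 2) * lam * l2 u u - (2 / γ) * κ * l2 v v)]
    exact (le_abs_self _).trans (abs_le_of_sq_le_sq hsq (add_nonneg hA hB))
  -- §C the mass bound for `u`
  have hmass : (γ / 2) * lam * l2 u u ≤
      crossBound L β R * l2 Ω Ω + ε * l2 Ω₁ Ω₁ + (1 + 2 / γ) * κ * l2 Ω Ω := by
    have h1 : lam * l2 w w - qform su2Rep β w w ≤ crossBound L β R * l2 Ω Ω + ε * l2 Ω₁ Ω₁ := by linarith only [hprod, hbr]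
    have h2 : qform su2Rep β w w ≤ (1 - γ) * lam * l2 u u + ((γ / 2) * lam * l2 u u + (2 / γ) * κ * l2 v v) + κ * l2 v v := by
      rw [hqw]; linarith only [hqu, hAMGM, hqv]
    have h3 : κ * l2 v v ≤ κ * l2 Ω Ω := mul_le_mul_of_nonneg_left hnvΩ hκ0
    have h4 : (2 / γ) * κ * l2 v v ≤ (2 / γ) * κ * l2 Ω Ω := mul_le_mul_of_nonneg_left hnvΩ (by positivity)
    have h5 : 0 ≤ lam * l2 v v := mul_nonneg hlam0.le hnv0
    rw [hnw] at h1
    nlinarith only [h1, h2, h3, h4, h5]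
  -- §D conclusion
  have hnu : l2 u u ≤ 2 / (γ * lam) * (crossBound L β R * l2 Ω Ω + ε * l2 Ω₁ Ω₁ + (1 + 2 / γ) * κ * l2 Ω Ω) := by
    have hγl : 0 < γ * lam := mul_pos hγ hlam0
    rw [div_mul_eq_mul_div, le_div_iff₀ hγl]
    have e : l2 u u * (γ * lam) = 2 * ((γ / 2) * lam * l2 u u) := by ring
    linarith only [hmass, e]
  have hnv : l2 v v ≤ κ / lam * l2 Ω Ω := by
    rw [div_mul_eq_mul_div, le_div_iff₀ hlam0]
    linarith only [htail, hnvc, hlam0, mul_le_mul_of_nonneg_right hnvc hlam0.le]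
  rw [hwΩ, hnw]
  linarith only [hnu, hnv]


end GroundConc

end Summit.QuantumFields.YangMills.Theorems.FemtoTransferGap

end
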